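import Literature.Analysis.FluidPDE.NSLerayRegularisedExistenceProofs
import HarnessLib

/-!
# Leray 1934, Ch. V §§26–27: the regularised scheme exists (`leray_regularised_scheme_exists`) — discharged

Proof file of `Literature/Analysis/FluidPDE/NSLerayRegularised`: **discharge of the named fact
`Literature.Analysis.FluidPDE.leray_regularised_scheme_exists`** (J. Leray, *Sur le mouvement d'un
liquide visqueux emplissant l'espace*, Acta Math. 63 (1934), Ch. V §26, pp. 231–232 (the regularised
problem with datum `\overline{U(x)}` = `J_ε u₀` has a unique regular solution defined for all `t > 0`,
with the energy equality) and §27, pp. 232–235, (5.1)–(5.7) (la répartition de l'énergie cinétique à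
grande distance, with constants "indépendants de `ε`"); modern statements Ożański–Pooley 2018,
Thm. 6.33 and Lemma 6.34 with (6.77)–(6.86), as used in the proof of Thm. 6.37 with datum `J_ε u₀`,
(6.88); Robinson–Rodrigo–Sadowski 2016, Thm. 14.1 and Prop. 14.3): for every `ν > 0` and every weakly
divergence-free `u₀ ∈ L²(ℝ³)` there are bump kernels `φ n` with radii `→ 0` and fields `U n` forming a
Leray regularised scheme `IsLerayRegularisedScheme ν u₀ φ U`.

The proof is the composition of two accepted tree results, following Leray's own argument:

* `leray_regularised_wellposed_holds` (`NSLerayRegularisedExistenceProofs.lean`): for a single bump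
  kernel `χ`, the regularised problem `∂ₜu − νΔu + ((J_χu)·∇)u + ∇p = 0`, `div u = 0`, `u(0) = J_χ u₀`
  is globally well posed with the energy equality and the `χ`-uniform separation of energy
  (Leray §§26–27; OP 2018 Thm. 6.33, Lemma 6.34);
* `leray_regularised_scheme_exists_of_wellposed` (`NSLerayRegularisedExistence.lean`): running that
  single-kernel statement along a sequence of bump kernels with radii `→ 0`
  (`FunctionSpaces.exists_contDiffBump_seq`) yields the scheme.

Theorem-only glue module: no definitions, no named facts, no `sorry`; a pure proof of the unchanged
statement `leray_regularised_scheme_exists` (it cannot live in `NSLerayRegularised.lean` itself, which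
`NSLerayRegularisedExistenceProofs` imports). With `leray_regularised_limit_holds`
(`NSLerayRegularisedLimitHolds.lean`) this is the existence half of `leray_existence_R3`
(`leray_existence_R3_of_scheme_exists`; the composed discharge `leray_existence_R3_holds` is
`NSLerayExistenceR3Holds.lean`).

## Mathlib / tree search

`leray_regularised_scheme_exists_holds` / `: leray_regularised_scheme_exists :=`: no prior discharge
in `Literature/` or `Summits/` (2026-08-15T08:50Z); ingredients at
`NSLerayRegularisedExistence.lean:113` and `NSLerayRegularisedExistenceProofs.lean:61`.

## References

* J. Leray, *Sur le mouvement d'un liquide visqueux emplissant l'espace*, Acta Math. 63 (1934),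
  193–248, Ch. V §26 (pp. 231–232), §27 (pp. 232–235, (5.1)–(5.7)). [Leray1934]
* W. S. Ożański, B. C. Pooley, *Leray's fundamental work on the Navier–Stokes equations: a modern
  review of "Sur le mouvement d'un liquide visqueux emplissant l'espace"*, LMS Lecture Note Ser.
  452 (CUP 2018) = arXiv:1708.09787, Def. 6.32, Thm. 6.33, Lemma 6.34, (6.77)–(6.88).
  [OzanskiPooley2018]
* J. C. Robinson, J. L. Rodrigo, W. Sadowski, *The Three-Dimensional Navier–Stokes Equations*,
  CUP (2016), Thm. 14.1, Prop. 14.3. [RobinsonRodrigoSadowski2016]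
-/

noncomputable section

namespace Literature.Analysis.FluidPDE

/-- **Existence of the Leray regularised scheme on `ℝ³`, proved** (the named statement
`leray_regularised_scheme_exists`: for every `ν > 0` and every weakly divergence-free `u₀ ∈ L²(ℝ³)`
there are bump kernels `φ n` with radii `→ 0` and global smooth finite-energy solutions `U n` of the
regularised problems with data `J_{φ n} u₀`, the energy equality, Leray's regularised weak form and the
`n`-uniform separation of energy — Leray 1934, Ch. V §§26–27; Ożański–Pooley 2018, Thm. 6.33 and
Lemma 6.34 as used in the proof of Thm. 6.37), by `leray_regularised_scheme_exists_of_wellposed`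
applied to `leray_regularised_wellposed_holds`.
[cite: Leray1934, Ch. V §§26–27, pp. 231–235, (5.1)–(5.7)] -/
theorem leray_regularised_scheme_exists_holds : leray_regularised_scheme_exists :=
  leray_regularised_scheme_exists_of_wellposed leray_regularised_wellposed_holds

end Literature.Analysis.FluidPDE

end
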